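import Summits.HodgeConjecture.HodgeConjecture.Theorems.HeckePrymWeilIsoInvariance
import Summits.HodgeConjecture.HodgeConjecture.Theorems.HeckePrymWeilWeilDescendingProof
import Summits.HodgeConjecture.HodgeConjecture.Theorems.HeckePrymWeilProductDescentClose
import Summits.HodgeConjecture.HodgeConjecture.Theorems.HeckePrymWeilLadderGlue
import Summits.HodgeConjecture.HodgeConjecture.Theorems.HeckePrymWeilAimedDescendingProof
import Summits.HodgeConjecture.HodgeConjecture.Theorems.HeckePrymWeilEightfoldDescentGlue
import Summits.HodgeConjecture.HodgeConjecture.Theorems.HeckePrymWeilFamilySectorGlue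
import Summits.HodgeConjecture.HodgeConjecture.Theorems.HeckePrymWeilAssembly
import Summits.HodgeConjecture.HodgeConjecture.Theorems.SummitOffWeilSector.Negative.ConjectureGrade

/-! q1 equivalence audit of crux `SummitOffWeilSector` (stmt-HodgeConjecture-14374): kernel-level facts
about the PROVED siblings of the route `HeckePrymWeil` and the exact shape of the suspect equivalence. -/

open Summit.HodgeConjecture.HodgeConjecture

namespace Q1Audit

-- (0) each proved sibling closes its route decl BY NAME with no hypothesis
example : Theses.HeckePrymWeil.IsoInvariance := Theorems.isoInvariance_proof
example : Theses.HeckePrymWeil.WeilDescending := Theorems.weilDescending_proof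
example : Theses.HeckePrymWeil.ProductDescent := Theorems.productDescent_proof
example : Theses.HeckePrymWeil.LadderGlue := Theorems.heckePrymWeil_ladderGlue_proof
example : Theses.HeckePrymWeil.AimedDescending := Theorems.aimedDescending_proof
example : Theses.HeckePrymWeil.EightfoldDescentGlue := Theorems.eightfoldDescentGlue_proof
example : Theses.HeckePrymWeil.FamilySectorGlue := Theorems.familySectorGlue_proof
example : Theses.HeckePrymWeil.Assembly := Theorems.heckePrymWeil_assembly_proof

#print axioms Summit.HodgeConjecture.HodgeConjecture.Theorems.isoInvariance_proof
#print axioms Summit.HodgeConjecture.HodgeConjecture.Theorems.weilDescending_proof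
#print axioms Summit.HodgeConjecture.HodgeConjecture.Theorems.productDescent_proof
#print axioms Summit.HodgeConjecture.HodgeConjecture.Theorems.heckePrymWeil_ladderGlue_proof
#print axioms Summit.HodgeConjecture.HodgeConjecture.Theorems.aimedDescending_proof
#print axioms Summit.HodgeConjecture.HodgeConjecture.Theorems.eightfoldDescentGlue_proof
#print axioms Summit.HodgeConjecture.HodgeConjecture.Theorems.familySectorGlue_proof
#print axioms Summit.HodgeConjecture.HodgeConjecture.Theorems.heckePrymWeil_assembly_proof

open Theses.HeckePrymWeil

/-- The antecedent of the crux (the ℚ(√-p) Hodge–Weil sector), named. -/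
def Sector : Prop :=
  ∀ p : ℕ, p.Prime → p % 4 = 3 → 7 ≤ p → ∀ n : ℕ, 1 ≤ n → ∀ (A : Literature.AlgebraicGeometry.Motives.AbelianVariety ℂ) (φ : A ⟶ A), A.dim = 2 * n → CategoryTheory.CategoryStruct.comp φ φ = -((p : ℤ) • CategoryTheory.CategoryStruct.id A) → ∀ c : Literature.AlgebraicGeometry.HodgeTheory.complexBetti A.X (2 * n), Literature.AlgebraicGeometry.HodgeTheory.IsRationalClass c → Literature.AlgebraicGeometry.HodgeTheory.IsOfHodgeType (2 * n) A.X (2 * n) n n c → c ∈ Module.End.eigenspace (Literature.AlgebraicGeometry.HodgeTheory.complexBetti.map (CategoryTheory.CategoryStruct.id A + φ).hom.hom.hom (2 * n)).hom ((1 + Complex.I * (Real.sqrt ↑p : ℂ)) ^ (2 * n)) ⊔ Module.End.eigenspace (Literature.AlgebraicGeometry.HodgeTheory.complexBetti.map (CategoryTheory.CategoryStruct.id A + φ).hom.hom.hom (2 * n)).hom ((1 - Complex.I * (Real.sqrt ↑p : ℂ)) ^ (2 * n)) → c ∈ Literature.AlgebraicGeometry.HodgeTheory.algebraicClasses A.X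 n

-- (1) the crux IS `Sector → HodgeConjecture`, definitionally
theorem crux_iff : SummitOffWeilSector ↔ (Sector → _root_.HodgeConjecture) := Iff.rfl

-- (2) the suspect equivalence in its exact form: S → B outright (the witness shape) …
theorem b_of_s : _root_.HodgeConjecture → SummitOffWeilSector := fun h _ => h

-- … and B → S only THROUGH the sector: the summit is exactly `Sector ∧ B` (a bridge split T ∧ (T → S))
theorem s_iff_sector_and_b : _root_.HodgeConjecture ↔ (Sector ∧ SummitOffWeilSector) := by
  constructor
  · intro h
    refine ⟨?_, fun _ => h⟩
    intro p hp hp4 hp7 n hn A φ hdim hφ c hc hcH hcW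
    exact Theorems.SummitOffWeilSector.Negative.antecedent_of_hodgeConjecture h p hp hp4 hp7 n hn A φ hdim hφ c hc hcH hcW
  · rintro ⟨hT, hB⟩
    exact hB hT

-- (3) none of the eight proved siblings is, or contains, the sector: the cheapest collapse attempts fail
--     (heavier batteries — tauto / simp_all / aesop — time out unfolding the defs, as the refuters recorded).
example (hI : IsoInvariance) (hD : WeilDescending) (hP : ProductDescent) (hL : LadderGlue)
    (hAD : AimedDescending) (hE : EightfoldDescentGlue) (hF : FamilySectorGlue) (hAsm : Assembly) :
    SummitOffWeilSector → _root_.HodgeConjecture := by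
  intro hB
  fail_if_success exact hB (by assumption)
  fail_if_success assumption
  sorry

end Q1Audit
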